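import Literature.MathematicalPhysics.QuantumFieldTheory.OSTimeBoundaryValue
import Literature.MathematicalPhysics.QuantumFieldTheory.OSTimeTubeUniqueness
import Literature.MathematicalPhysics.QuantumFieldTheory.LorentzSpectralSupport
import Literature.Analysis.FunctionSpaces.SchwartzExpMultiplier
import Literature.Analysis.FunctionSpaces.SchwartzDistributionSupport
import Mathlib.Analysis.Analytic.IsolatedZeros
import Mathlib.Analysis.Complex.CauchyIntegral
import HarnessLib

/-!
# (A2) `OS1975_boundaryValue_of_timeContinuation` holds: the Paley–Wiener step, the half-space spectral support, and the discharge

`Literature.MathematicalPhysics.QuantumFieldTheory.OSTimeContinuation` decomposes the analytic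
core (A₁₂) of the Osterwalder–Schrader reconstruction theorem into the named facts (A1), (A2), (B),
(D) and proves the assembly. This file **discharges (A2)**
`OS1975_boundaryValue_of_timeContinuation` — Osterwalder–Schrader II (Comm. Math. Phys. 42
(1975)), §IV.2, p. 289: "By standard arguments (see Vladimirov, p. 235 ff.) Theorem 4.3 implies
that there exist unique distributions `W̃_k ∈ 𝒮'(ℝ^{4k})` with support in `ℝ̄₊^{4k}` such that
`S_k` are the Fourier–Laplace transform of them … `W_k(h) = lim_{η⁰→0⁺} ∫ S_k(η⁰ + iξ⁰|ξ⃗) h(ξ) dξ`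
satisfies `|W_k(h)| ≤ w_k |h|_{kt''}`" (4.7) — in H21's point variables: a function `𝔚` continuous
on the time tube, holomorphic in the times, invariant under real diagonal translations and of OS
growth has a tempered time-ray boundary value `T` (`HasTimeRayBoundaryValue`) whose Fourier
transform is supported in the half-space spectral set (`FourierSupportedIn T (halfSpectralSet d n)`).

The existence of `T`, for every temporal direction, is `exists_clm_tendsto_integral_rayC_I` of the
sibling file `OSTimeBoundaryValue` (Hörmander's second proof of Thm. 3.1.11/3.1.15 in the Schwartz
class, built on the slice analysis of `OSTimeSlice`). This file supplies the **spectral support**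
and the assembly:

1. **The Paley–Wiener step** (`integral_rayC_I_mul_fourierInv_expMult_eq_zero`; Streater–Wightman
   (1964), Thm. 2-8 / Vladimirov (1966), §26.3, proved directly). Let `y ∈ T₊`, `θ_d` a purely
   temporal direction with non-negative time gaps (so `y + sθ_d ∈ T₊` for `s ≥ 0`), `v = θ̃_d` its
   flattening, `θ ∈ C_c^∞(ℝ)` with `supp θ ⊆ [ε, ∞)`, `ε > 0`, and `G ∈ 𝓢`. Then
   `∫ 𝔚(x + iy) · 𝓕⁻¹(θ(⟨·, v⟩) G)(x̃) dx = 0`. Proof: with the exponential multipliers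
   `m_κ = θ(⟨·, v⟩) e^{2πiκ⟨·, v⟩}` (`Literature.Analysis.FunctionSpaces.expMult`) put
   `F_κ = 𝓕⁻¹(m_κ G) ∘ flatten` and `h(κ) = ∫ 𝔚((x + iy) + κθ_d) F_κ(x) dx`. (i) `h` is holomorphic
   on the open convex set `U = {κ | y + Im κ θ_d ∈ T₊} ⊇ {Im κ ≥ 0}` (dominated holomorphic
   parameter integral: both factors are holomorphic in `κ`, the OS growth bounds the first
   polynomially in `x`, the uniform Schwartz decay of `𝓕⁻¹(m_κ G)` beats it); (ii) for real
   `κ = u`, `(x + iy) + uθ_d = (x + uθ_d) + iy` and `F_u(x) = F_0(x + uθ_d)` (Fourier shift), so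
   `h(u) = h(0)` by translation invariance of Lebesgue measure; (iii) by the identity theorem
   `h ≡ h(0)` on `U`; (iv) `h(is) → 0` as `s → +∞`, because `‖𝔚(x + i(y + sθ_d))‖` grows at most
   like `(1 + s)ᴺ` while `F_{is}` decays like `e^{−2πεs}`. Hence `h(0) = 0`.
2. **The half-space spectral support** (`fourierSupportedIn_halfSpectralSet_of_tendsto`). On the
   Fourier side `T' = T ∘ unflatten ∘ 𝓕⁻¹` must vanish on the complement of the half-space spectral
   set, which is covered (`compl_image_halfSpectralSet_subset`) by the open sets
   `U_μ = {∑ⱼ p_j^μ ≠ 0}` and `V_k = {∑_{j > k} p_j⁰ > 0}`; by the sheaf property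
   (`Literature.Analysis.FunctionSpaces.SchwartzSupport.isVanishingOn_iUnion`) and compact
   reduction (`isVanishingOnCompact_preimage`) it suffices to treat test functions `θ(ℓ(p)) G(p)`
   with `θ ∈ C_c^∞` supported in `{r ≠ 0}` resp. `(0, ∞)`: on `U_μ` by **translation invariance**
   (`θ(r) = r · (θ(r)/r)`, `𝓕⁻¹(⟨·, m⟩ψ) = (2πi)⁻¹ ∂_m 𝓕⁻¹ψ` — Mathlib's
   `SchwartzMap.lineDerivOp_fourierInv_eq` — and `T(∂_â F) = 0` for diagonal `â`,
   `apply_lineDerivOp_diag_eq_zero`); on `V_k` by the **Paley–Wiener step** with the upper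
   temporal direction `(0, …, 0, e₀, …, e₀)` (ones at the indices `> k`).
3. **The discharge** `OS1975_boundaryValue_of_timeContinuation_holds`, and the assemblies of
   `OSTimeContinuation` with (A2) and (D) (`eqOn_timeTube_of_timeRayBoundaryValue_holds`,
   `OSTimeTubeUniqueness`) discharged: `OS1975_exists_continuation_halfSpace_of_A1_B`,
   `OS1975_exists_forwardTube_continuation_of_A1_B`, `os_reconstruction_of_A1_B`.

Sign conventions are those of `HasSpectralCondition` / `spectralSet` (Mathlib's `𝓕` with kernel
`e^{−2πi⟨x, ξ⟩}` on the flattening): the boundary value from INSIDE the forward time tube has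
`𝓕`-side support where the upper partial energy sums `∑_{j > k} p_j⁰` are `≤ 0`, i.e. — given
`∑ pⱼ = 0` — where `(∑_{j ≤ k} pⱼ)⁰ ≥ 0`, which is `halfSpectralSet` (OS I (1973), p. 93:
"support in `{q⁰_j ≥ 0}`").

## References

* K. Osterwalder, R. Schrader, *Axioms for Euclidean Green's functions II*, Comm. Math. Phys. 42
  (1975) 281–305, §IV.2 p. 289, Thm. 4.3, (4.6)–(4.7); *… I*, Comm. Math. Phys. 31 (1973),
  §4.1 (4.13), p. 93. [OsterwalderSchraderCMP1975]
* R. F. Streater, A. S. Wightman, *PCT, Spin and Statistics, and All That* (1964), Thms. 2-6–2-10,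
  §3-3 (3-13). [StreaterWightman1964]
* V. S. Vladimirov, *Methods of the Theory of Functions of Many Complex Variables* (1966), §26.
  [Vladimirov1966]
* L. Hörmander, *The Analysis of Linear Partial Differential Operators I*, Thms. 3.1.15,
  7.4.2–7.4.3. [HormanderALPDO1]
-/

noncomputable section

open MeasureTheory Filter Set Metric Complex FourierTransform
open scoped Topology SchwartzMap LineDeriv RealInnerProductSpace FourierTransform ContDiff
open Literature.MathematicalPhysics.QuantumLattice Literature.Analysis.FunctionSpaces
  Literature.Analysis.Distribution

namespace Literature.MathematicalPhysics.QuantumFieldTheory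

variable {d n : ℕ}

/-! ### Flattening: norms and translations -/

/-- The sup norm of a configuration is at most the Euclidean norm of its flattening (a private
copy of `norm_le_norm_flattenCLE` of `WightmanToSchwingerProofs`, to keep the import closure
small). [folklore] -/
private theorem norm_le_norm_flattenCLE' (x : Fin n → SpaceTime d) : ‖x‖ ≤ ‖flattenCLE d n x‖ := by
  have hsq : ‖flattenCLE d n x‖ ^ 2 = ∑ k, ‖x k‖ ^ 2 := by
    rw [← real_inner_self_eq_norm_sq, inner_flattenCLE]
    exact Finset.sum_congr rfl fun k _ => real_inner_self_eq_norm_sq (x k)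
  refine (pi_norm_le_iff_of_nonneg (norm_nonneg _)).2 fun k => ?_
  refine le_of_pow_le_pow_left₀ two_ne_zero (norm_nonneg _) ?_
  rw [hsq]
  exact Finset.single_le_sum (f := fun k => ‖x k‖ ^ 2) (fun j _ => by positivity) (Finset.mem_univ k)

/-- `(1 + ‖x̃‖)^{-M} ≤ (1 + ‖x‖)^{-M}`. [folklore] -/
theorem one_add_norm_flattenCLE_rpow_neg_le (x : Fin n → SpaceTime d) (M : ℕ) :
    (1 + ‖flattenCLE d n x‖) ^ (-(M : ℝ)) ≤ (1 + ‖x‖) ^ (-(M : ℝ)) := by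
  have h1 : 0 < 1 + ‖x‖ := by positivity
  have h2 : 0 < 1 + ‖flattenCLE d n x‖ := by positivity
  rw [Real.rpow_neg h1.le, Real.rpow_neg h2.le, Real.rpow_natCast, Real.rpow_natCast]
  refine inv_anti₀ (pow_pos h1 M) ?_
  gcongr
  exact norm_le_norm_flattenCLE' x

section Core

variable {𝔚 : (Fin n → Fin (d + 1) → ℂ) → ℂ} {C : ℝ} {N : ℕ}
  (hGc : ContinuousOn 𝔚 (timeTube d n)) (hGh : IsTimeHolomorphicOn 𝔚 (timeTube d n))
  (hG : ∀ z ∈ timeTube d n, ‖𝔚 z‖ ≤ C * (1 + ‖z‖) ^ N *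
    (1 + ∑ k, ((succDiff (fun j => z j 0) k).im)⁻¹) ^ N)

include hGh in
/-- Holomorphy in `κ` of `𝔚((x + iy) + κθ)` at admissible `κ` (the heights `y + Im κ θ` keeping
positive gaps), for `y, θ` purely temporal. [folklore] -/
theorem differentiableWithinAt_apply_rayC_I_add_smul {x y θ : Fin n → SpaceTime d}
    (hy : ∀ (k : Fin n) (i : Fin d), y k i.succ = 0) (hθ : ∀ (k : Fin n) (i : Fin d), θ k i.succ = 0)
    {κ : ℂ} (hκ : ∀ k, 0 < succDiff (fun j => y j 0) k + κ.im * succDiff (fun j => θ j 0) k) :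
    DifferentiableWithinAt ℂ (fun κ : ℂ => 𝔚 (rayC x y I + κ • cpxConfig θ))
      {κ : ℂ | ∀ k, 0 < succDiff (fun j => y j 0) k + κ.im * succDiff (fun j => θ j 0) k} κ := by
  have hUo : IsOpen {κ : ℂ | ∀ k, 0 < succDiff (fun j => y j 0) k + κ.im * succDiff (fun j => θ j 0) k} :=
    isOpen_setOf_im_gap_pos _ _
  have hmem : rayC x y I + κ • cpxConfig θ ∈ timeTube d n := rayC_I_add_smul_mem_timeTube hy hθ hκ
  have h := differentiableOn_apply_add_smul_cpxConfig hGh hmem hθ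
  have h' : DifferentiableOn ℂ (fun κ' : ℂ => 𝔚 (rayC x y I + κ' • cpxConfig θ))
      {κ' | rayC x y I + κ' • cpxConfig θ ∈ timeTube d n} := by
    have hshift : Differentiable ℂ fun κ' : ℂ => κ' - κ := differentiable_id.sub_const κ
    have hc := h.comp hshift.differentiableOn (fun κ' (hκ' : rayC x y I + κ' • cpxConfig θ ∈ timeTube d n) => by
      show rayC x y I + κ • cpxConfig θ + (κ' - κ) • cpxConfig θ ∈ timeTube d n
      rwa [add_assoc, ← add_smul, add_sub_cancel])
    refine hc.congr fun κ' _ => ?_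
    simp only [Function.comp_apply]
    rw [add_assoc, ← add_smul, add_sub_cancel]
  exact ((h'.mono fun κ' hκ' => rayC_I_add_smul_mem_timeTube hy hθ hκ').differentiableAt
    (hUo.mem_nhds hκ)).differentiableWithinAt

include hGc hGh hG in
/-- **The Paley–Wiener step.** For `y ∈ T₊`, a purely temporal direction `θ_d` with non-negative
gaps, `θ ∈ C_c^∞(ℝ)` supported in `[ε, ∞)` with `ε > 0`, and `G ∈ 𝓢`, the slice pairing of `𝔚`
at height `y` with `𝓕⁻¹(θ(⟨·, θ̃_d⟩) G) ∘ flatten` vanishes (module docstring for the proof).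
[cite: StreaterWightman1964, Thm 2-8] -/
theorem integral_rayC_I_mul_fourierInv_expMult_eq_zero {y θd : Fin n → SpaceTime d}
    (hy : y ∈ temporalCone d n) (hθd : ∀ (k : Fin n) (i : Fin d), θd k i.succ = 0)
    (hθdg : ∀ k, 0 ≤ succDiff (fun j => θd j 0) k) {θ : ℝ → ℂ} (hθ : ContDiff ℝ ∞ θ)
    (hθc : HasCompactSupport θ) {ε : ℝ} (hε : 0 < ε) (hθε : ∀ r ∈ tsupport θ, ε ≤ r)
    (G : 𝓢(EuclideanSpace ℝ (Fin n × Fin (d + 1)), ℂ)) :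
    ∫ x : Fin n → SpaceTime d, 𝔚 (rayC x y I) *
      (𝓕⁻ (SchwartzMap.smulLeftCLM ℂ (expMult θ (flattenCLE d n θd) 0) G) :
        𝓢(EuclideanSpace ℝ (Fin n × Fin (d + 1)), ℂ)) (flattenCLE d n x) = 0 := by
  have hy' := (mem_temporalCone_iff y).1 hy
  set v : EuclideanSpace ℝ (Fin n × Fin (d + 1)) := flattenCLE d n θd with hv
  -- the family of test functions and the function `h`
  set Fκ : ℂ → (Fin n → SpaceTime d) → ℂ := fun κ x =>
    (𝓕⁻ (SchwartzMap.smulLeftCLM ℂ (expMult θ v κ) G) :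
      𝓢(EuclideanSpace ℝ (Fin n × Fin (d + 1)), ℂ)) (flattenCLE d n x) with hFκ
  set h : ℂ → ℂ := fun κ => ∫ x : Fin n → SpaceTime d,
    𝔚 (rayC x y I + κ • cpxConfig θd) * Fκ κ x with hh
  set U : Set ℂ := {κ : ℂ | ∀ k, 0 < succDiff (fun j => y j 0) k + κ.im * succDiff (fun j => θd j 0) k}
    with hU
  have hUo : IsOpen U := isOpen_setOf_im_gap_pos _ _
  have hUc : IsPreconnected U := (convex_setOf_im_gap_pos _ _).isPreconnected
  have hImU : ∀ κ : ℂ, 0 ≤ κ.im → κ ∈ U := fun κ hκ k =>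
    add_pos_of_pos_of_nonneg (hy'.2 k) (mul_nonneg hκ (hθdg k))
  have h0U : (0 : ℂ) ∈ U := hImU 0 (by simp)
  have hmemT : ∀ κ ∈ U, y + κ.im • θd ∈ temporalCone d n := fun κ hκ => by
    rw [mem_temporalCone_iff]
    refine ⟨add_smul_apply_succ_eq_zero hy'.1 hθd _, fun k => ?_⟩
    rw [succDiff_time_add_smul]; exact hκ k
  -- continuity of the test functions in `x`
  have hFc : ∀ κ, Continuous (Fκ κ) := fun κ =>
    (SchwartzMap.continuous _).comp (flattenCLE d n).continuous
  -- decay of the test functions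
  set M : ℕ := N + Module.finrank ℝ (Fin n → SpaceTime d) + 1 with hM
  have hMr : (Module.finrank ℝ (Fin n → SpaceTime d) : ℝ) < ((Module.finrank ℝ (Fin n → SpaceTime d) + 1 : ℕ) : ℝ) := by
    push_cast; linarith
  obtain ⟨K, N₀, hK0, hdec⟩ := exists_decay_fourierInv_smulLeftCLM_expMult hθ hθc v M G
  have hFbound : ∀ (κ : ℂ) (ρ : ℝ), 0 ≤ ρ →
      (∀ r ∈ tsupport θ, Real.exp (-(2 * Real.pi * κ.im * r)) ≤ ρ) → ∀ x : Fin n → SpaceTime d,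
      ‖Fκ κ x‖ ≤ K * (1 + ‖κ‖) ^ N₀ * ρ * (1 + ‖x‖) ^ (-(M : ℝ)) := by
    intro κ ρ hρ hw x
    have h1 := hdec κ ρ hρ hw (flattenCLE d n x)
    have hpos : 0 < (1 + ‖flattenCLE d n x‖) ^ M := by positivity
    have h2 : ‖Fκ κ x‖ ≤ K * (1 + ‖κ‖) ^ N₀ * ρ * (1 + ‖flattenCLE d n x‖) ^ (-(M : ℝ)) := by
      rw [Real.rpow_neg (by positivity), Real.rpow_natCast, ← div_eq_mul_inv, le_div_iff₀ hpos,
        mul_comm]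
      exact h1
    refine h2.trans ?_
    exact mul_le_mul_of_nonneg_left (one_add_norm_flattenCLE_rpow_neg_le x M) (by positivity)
  -- a bound for `|r|` on the support of `θ`
  obtain ⟨R₀, hR₀⟩ := (hθc.isCompact.isBounded).subset_closedBall 0
  set Rθ : ℝ := max R₀ 0 with hRθ
  have hRθ0 : 0 ≤ Rθ := le_max_right _ _
  have hRθ' : ∀ r ∈ tsupport θ, |r| ≤ Rθ := fun r hr => by
    have := hR₀ hr
    rw [mem_closedBall, dist_zero_right, Real.norm_eq_abs] at this
    exact this.trans (le_max_left _ _)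
  ---------------------------------------------------------------------------------------------
  -- (i) holomorphy of `h` on `U`
  ---------------------------------------------------------------------------------------------
  have hdiff : DifferentiableOn ℂ h U := by
    refine Literature.Analysis.Complex.differentiableOn_integral_of_dominated
      (F := fun κ x => 𝔚 (rayC x y I + κ • cpxConfig θd) * Fκ κ x) (μ := volume) ?_ ?_ ?_
    · intro κ hκ
      have hc : Continuous fun x : Fin n → SpaceTime d => 𝔚 (rayC x y I + κ • cpxConfig θd) := by
        have h1 := continuous_apply_rayC_I hGc (hmemT κ hκ)
        have h2 : Continuous fun x : Fin n → SpaceTime d => x + κ.re • θd :=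
          continuous_id.add continuous_const
        refine (h1.comp h2).congr fun x => ?_
        simp only [Function.comp_apply, rayC_I_add_smul_cpxConfig]
      exact (hc.mul (hFc κ)).aestronglyMeasurable
    · refine Eventually.of_forall fun x => ?_
      intro κ hκ
      refine DifferentiableWithinAt.mul ?_ ?_
      · exact differentiableWithinAt_apply_rayC_I_add_smul hGh hy'.1 hθd hκ
      · exact ((differentiable_fourierInv_smulLeftCLM_expMult hθ hθc v G (flattenCLE d n x)) κ)
          |>.differentiableWithinAt
    · intro κ₀ hκ₀
      obtain ⟨R, hR, hball⟩ := Metric.isOpen_iff.1 hUo κ₀ hκ₀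
      set r : ℝ := min (R / 2) 1 with hr
      have hr0 : 0 < r := lt_min (half_pos hR) one_pos
      have hrR : r < R := (min_le_left _ _).trans_lt (half_lt_self hR)
      have hr1 : r ≤ 1 := min_le_right _ _
      have hcl : closedBall κ₀ r ⊆ U := (closedBall_subset_ball hrR).trans hball
      -- the compact set of heights and the growth bound for `𝔚`
      set Kh : Set (Fin n → SpaceTime d) := (fun κ : ℂ => y + κ.im • θd) '' closedBall κ₀ r with hKh
      have hKhc : IsCompact Kh := (isCompact_closedBall κ₀ r).image
        (continuous_const.add (continuous_im.smul continuous_const))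
      have hKhT : Kh ⊆ temporalCone d n := by
        rintro _ ⟨κ, hκ, rfl⟩; exact hmemT κ (hcl hκ)
      obtain ⟨A, hA0, hA⟩ := exists_norm_apply_rayC_I_le_of_isCompact hG hKhc hKhT
      set B : ℝ := (1 + (‖κ₀‖ + 1) * ‖θd‖) ^ N with hB
      set ρ : ℝ := Real.exp (2 * Real.pi * (‖κ₀‖ + 1) * Rθ) with hρ
      set KF : ℝ := K * (2 + ‖κ₀‖) ^ N₀ * ρ with hKF
      have hKF0 : 0 ≤ KF := by positivity
      -- the majorant
      have hint : Integrable (fun x : Fin n → SpaceTime d =>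
          (1 + ‖x‖) ^ (-((Module.finrank ℝ (Fin n → SpaceTime d) + 1 : ℕ) : ℝ))) volume :=
        integrable_one_add_norm hMr
      refine ⟨r, hr0, (ball_subset_closedBall).trans hcl,
        fun x => A * B * KF * (1 + ‖x‖) ^ (-((Module.finrank ℝ (Fin n → SpaceTime d) + 1 : ℕ) : ℝ)),
        hint.const_mul (A * B * KF), Eventually.of_forall fun x κ hκ => ?_⟩
      have hκ' : κ ∈ closedBall κ₀ r := ball_subset_closedBall hκ
      have hκn : ‖κ‖ ≤ ‖κ₀‖ + 1 := by
        have := mem_closedBall_iff_norm.1 hκ'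
        calc ‖κ‖ = ‖κ₀ + (κ - κ₀)‖ := by rw [add_sub_cancel]
          _ ≤ ‖κ₀‖ + ‖κ - κ₀‖ := norm_add_le _ _
          _ ≤ ‖κ₀‖ + 1 := by linarith
      -- first factor
      have hyK : y + κ.im • θd ∈ Kh := ⟨κ, hκ', rfl⟩
      have h1 := hA _ hyK (x + κ.re • θd)
      rw [← rayC_I_add_smul_cpxConfig] at h1
      have hre : ‖κ.re • θd‖ ≤ (‖κ₀‖ + 1) * ‖θd‖ := by
        rw [norm_smul]
        exact mul_le_mul_of_nonneg_right ((abs_re_le_norm κ).trans hκn) (norm_nonneg _)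
      have hx : 1 + ‖x + κ.re • θd‖ ≤ (1 + (‖κ₀‖ + 1) * ‖θd‖) * (1 + ‖x‖) := by
        have h2 := norm_add_le x (κ.re • θd)
        have h3 : 0 ≤ (‖κ₀‖ + 1) * ‖θd‖ * ‖x‖ := by positivity
        nlinarith [h2, hre, h3]
      have hW : ‖𝔚 (rayC x y I + κ • cpxConfig θd)‖ ≤ A * B * (1 + ‖x‖) ^ N := by
        calc ‖𝔚 (rayC x y I + κ • cpxConfig θd)‖ ≤ A * (1 + ‖x + κ.re • θd‖) ^ N := h1
          _ ≤ A * ((1 + (‖κ₀‖ + 1) * ‖θd‖) * (1 + ‖x‖)) ^ N := by gcongr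
          _ = A * B * (1 + ‖x‖) ^ N := by rw [hB, mul_pow]; ring
      -- second factor
      have hρκ : ∀ r ∈ tsupport θ, Real.exp (-(2 * Real.pi * κ.im * r)) ≤ ρ := fun r hr =>
        (exp_neg_le_exp_norm hRθ' κ r hr).trans (Real.exp_le_exp.2 (by
          have : ‖κ‖ * Rθ ≤ (‖κ₀‖ + 1) * Rθ := mul_le_mul_of_nonneg_right hκn hRθ0
          nlinarith [Real.pi_pos]))
      have hF1 := hFbound κ ρ (by positivity) hρκ x
      have hF2 : ‖Fκ κ x‖ ≤ KF * (1 + ‖x‖) ^ (-(M : ℝ)) := by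
        refine hF1.trans (mul_le_mul_of_nonneg_right ?_ (by positivity))
        have hpow : (1 + ‖κ‖) ^ N₀ ≤ (2 + ‖κ₀‖) ^ N₀ :=
          pow_le_pow_left₀ (by positivity) (by linarith) N₀
        rw [hKF]
        exact mul_le_mul_of_nonneg_right (mul_le_mul_of_nonneg_left hpow hK0) (by positivity)
      -- combine
      have hsplit : (1 + ‖x‖) ^ N * (1 + ‖x‖) ^ (-(M : ℝ)) =
          (1 + ‖x‖) ^ (-((Module.finrank ℝ (Fin n → SpaceTime d) + 1 : ℕ) : ℝ)) := by
        have h1' : 0 < 1 + ‖x‖ := by positivity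
        rw [← Real.rpow_natCast, ← Real.rpow_add h1', hM]
        congr 1
        push_cast
        ring
      rw [norm_mul]
      calc ‖𝔚 (rayC x y I + κ • cpxConfig θd)‖ * ‖Fκ κ x‖
          ≤ (A * B * (1 + ‖x‖) ^ N) * (KF * (1 + ‖x‖) ^ (-(M : ℝ))) :=
            mul_le_mul hW hF2 (norm_nonneg _) (by positivity)
        _ = A * B * KF * ((1 + ‖x‖) ^ N * (1 + ‖x‖) ^ (-(M : ℝ))) := by ring
        _ = A * B * KF * (1 + ‖x‖) ^ (-((Module.finrank ℝ (Fin n → SpaceTime d) + 1 : ℕ) : ℝ)) := by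
            rw [hsplit]
  ---------------------------------------------------------------------------------------------
  -- (ii) `h` is constant on the real axis
  ---------------------------------------------------------------------------------------------
  have hreal : ∀ u : ℝ, h u = h 0 := by
    intro u
    have hshift : ∀ x : Fin n → SpaceTime d, Fκ u x = Fκ 0 (x + u • θd) := by
      intro x
      simp only [hFκ]
      rw [fourierInv_smulLeftCLM_expMult_ofReal hθ hθc v u G, (flattenCLE d n).map_add,
        (flattenCLE d n).map_smul]
    have hg : ∀ x : Fin n → SpaceTime d,
        𝔚 (rayC x y I + (u : ℂ) • cpxConfig θd) * Fκ u x =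
          (fun x' => 𝔚 (rayC x' y I) * Fκ 0 x') (x + u • θd) := by
      intro x
      simp only [rayC_I_add_smul_cpxConfig, Complex.ofReal_re, Complex.ofReal_im, zero_smul,
        add_zero, hshift]
    simp only [hh, hg, zero_smul, add_zero]
    rw [integral_add_right_eq_self (μ := volume) (fun x' => 𝔚 (rayC x' y I) * Fκ 0 x') (u • θd)]
  ---------------------------------------------------------------------------------------------
  -- (iii) identity theorem: `h ≡ h 0` on `U`
  ---------------------------------------------------------------------------------------------
  have hconst : EqOn h (fun _ => h 0) U := by
    have han : AnalyticOnNhd ℂ h U := (analyticOnNhd_iff_differentiableOn hUo).2 hdiff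
    refine han.eqOn_of_preconnected_of_frequently_eq analyticOnNhd_const hUc h0U ?_
    -- the reals `≠ 0` accumulate at `0`
    have htend : Tendsto (fun u : ℝ => (u : ℂ)) (𝓝[≠] 0) (𝓝[≠] 0) := by
      refine tendsto_nhdsWithin_iff.2 ⟨?_, ?_⟩
      · have h := Complex.continuous_ofReal.tendsto (0 : ℝ)
        rw [Complex.ofReal_zero] at h
        exact h.mono_left nhdsWithin_le_nhds
      · filter_upwards [self_mem_nhdsWithin] with u (hu : u ≠ 0)
        exact Complex.ofReal_ne_zero.2 hu
    exact htend.frequently (Eventually.of_forall fun u => hreal u).frequently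
  ---------------------------------------------------------------------------------------------
  -- (iv) decay along the positive imaginary axis
  ---------------------------------------------------------------------------------------------
  have hdecay : Tendsto (fun s : ℝ => h (I * s)) atTop (𝓝 0) := by
    -- growth constant for `𝔚` along `y + sθd`
    set A₁ : ℝ := C * ((1 + ‖y‖) ^ N * (1 + ∑ k, (succDiff (fun j => y j 0) k)⁻¹) ^ N *
      (1 + ‖θd‖) ^ N) with hA₁
    have hC := nonneg_of_osGrowth hG
    have hgapY : 0 ≤ 1 + ∑ k, (succDiff (fun j => y j 0) k)⁻¹ :=
      add_nonneg zero_le_one (Finset.sum_nonneg fun k _ => (inv_pos.2 (hy'.2 k)).le)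
    have hA₁0 : 0 ≤ A₁ := mul_nonneg hC (mul_nonneg (mul_nonneg (by positivity)
      (pow_nonneg hgapY N)) (by positivity))
    set J : ℝ := ∫ x : Fin n → SpaceTime d,
      (1 + ‖x‖) ^ (-((Module.finrank ℝ (Fin n → SpaceTime d) + 1 : ℕ) : ℝ)) with hJ
    have hint : Integrable (fun x : Fin n → SpaceTime d =>
        (1 + ‖x‖) ^ (-((Module.finrank ℝ (Fin n → SpaceTime d) + 1 : ℕ) : ℝ))) volume :=
      integrable_one_add_norm hMr
    have hJ0 : 0 ≤ J := integral_nonneg fun x => by positivity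
    -- the bound `‖h (is)‖ ≤ A₁ K J (1 + s)^{N + N₀} e^{-2π ε s}` for `s ≥ 0`
    have hbound : ∀ s : ℝ, 0 ≤ s → ‖h (I * s)‖ ≤
        A₁ * K * J * ((1 + s) ^ (N + N₀) * Real.exp (-(2 * Real.pi * s * ε))) := by
      intro s hs
      have hmem := add_smul_mem_temporalCone hy hθd hθdg hs
      set ρ : ℝ := Real.exp (-(2 * Real.pi * s * ε)) with hρ
      have hρκ : ∀ r ∈ tsupport θ, Real.exp (-(2 * Real.pi * (I * (s : ℂ)).im * r)) ≤ ρ :=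
        exp_neg_le_exp_neg_of_le hθε hs
      have hnormκ : ‖I * (s : ℂ)‖ = s := by
        rw [norm_mul, Complex.norm_I, one_mul, Complex.norm_real, Real.norm_eq_abs, abs_of_nonneg hs]
      have hpt : ∀ x : Fin n → SpaceTime d,
          ‖𝔚 (rayC x y I + (I * (s : ℂ)) • cpxConfig θd) * Fκ (I * s) x‖ ≤
            A₁ * K * ((1 + s) ^ (N + N₀) * ρ) *
              (1 + ‖x‖) ^ (-((Module.finrank ℝ (Fin n → SpaceTime d) + 1 : ℕ) : ℝ)) := by
        intro x
        have h1 : ‖𝔚 (rayC x y I + (I * (s : ℂ)) • cpxConfig θd)‖ ≤ A₁ * (1 + s) ^ N * (1 + ‖x‖) ^ N := by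
          have h := norm_apply_rayC_I_add_smul_le hG hy hθd hθdg hs x
          rw [rayC_I_add_smul_cpxConfig]
          simpa [hA₁] using h
        have h2 : ‖Fκ (I * s) x‖ ≤ K * (1 + s) ^ N₀ * ρ * (1 + ‖x‖) ^ (-(M : ℝ)) := by
          have h := hFbound (I * s) ρ (by positivity) hρκ x
          rwa [hnormκ] at h
        have hsplit : (1 + ‖x‖) ^ N * (1 + ‖x‖) ^ (-(M : ℝ)) =
            (1 + ‖x‖) ^ (-((Module.finrank ℝ (Fin n → SpaceTime d) + 1 : ℕ) : ℝ)) := by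
          have h1' : 0 < 1 + ‖x‖ := by positivity
          rw [← Real.rpow_natCast, ← Real.rpow_add h1', hM]
          congr 1
          push_cast
          ring
        rw [norm_mul]
        calc ‖𝔚 (rayC x y I + (I * (s : ℂ)) • cpxConfig θd)‖ * ‖Fκ (I * s) x‖
            ≤ (A₁ * (1 + s) ^ N * (1 + ‖x‖) ^ N) * (K * (1 + s) ^ N₀ * ρ * (1 + ‖x‖) ^ (-(M : ℝ))) :=
              mul_le_mul h1 h2 (norm_nonneg _) (by positivity)
          _ = A₁ * K * ((1 + s) ^ (N + N₀) * ρ) * ((1 + ‖x‖) ^ N * (1 + ‖x‖) ^ (-(M : ℝ))) := by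
              rw [pow_add]; ring
          _ = A₁ * K * ((1 + s) ^ (N + N₀) * ρ) *
              (1 + ‖x‖) ^ (-((Module.finrank ℝ (Fin n → SpaceTime d) + 1 : ℕ) : ℝ)) := by
              rw [hsplit]
      calc ‖h (I * s)‖ ≤ ∫ x : Fin n → SpaceTime d, A₁ * K * ((1 + s) ^ (N + N₀) * ρ) *
            (1 + ‖x‖) ^ (-((Module.finrank ℝ (Fin n → SpaceTime d) + 1 : ℕ) : ℝ)) :=
            norm_integral_le_of_norm_le (hint.const_mul _) (Eventually.of_forall hpt)
        _ = A₁ * K * J * ((1 + s) ^ (N + N₀) * Real.exp (-(2 * Real.pi * s * ε))) := by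
            rw [MeasureTheory.integral_const_mul, ← hJ, hρ]; ring
    -- the majorant tends to zero
    have hmaj : Tendsto (fun s : ℝ => A₁ * K * J * ((1 + s) ^ (N + N₀) *
        Real.exp (-(2 * Real.pi * s * ε)))) atTop (𝓝 0) := by
      have hc : 0 < Real.pi * ε := by positivity
      -- `(1 + s)^m e^{-2cs} = [(1 + s)^m e^{-cs}] e^{-cs} ≤ K' e^{-cs}`
      have hexp : Tendsto (fun s : ℝ => Real.exp (-(Real.pi * ε * s))) atTop (𝓝 0) := by
        have h1 := Real.tendsto_exp_neg_atTop_nhds_zero.comp (tendsto_id.const_mul_atTop hc)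
        refine h1.congr fun s => ?_
        simp [Function.comp_apply]
      have hbd2 : ∀ s : ℝ, 0 ≤ s → (1 + s) ^ (N + N₀) * Real.exp (-(2 * Real.pi * s * ε)) ≤
          ((N + N₀).factorial / (Real.pi * ε) ^ (N + N₀) * Real.exp (Real.pi * ε)) *
            Real.exp (-(Real.pi * ε * s)) := by
        intro s hs
        have h := one_add_pow_mul_exp_neg_le hc (N + N₀) hs
        have hsplit : Real.exp (-(2 * Real.pi * s * ε)) =
            Real.exp (-(Real.pi * ε * s)) * Real.exp (-(Real.pi * ε * s)) := by
          rw [← Real.exp_add]; congr 1; ring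
        rw [hsplit, ← mul_assoc]
        exact mul_le_mul_of_nonneg_right h (Real.exp_pos _).le
      have hlim2 : Tendsto (fun s : ℝ => ((N + N₀).factorial / (Real.pi * ε) ^ (N + N₀) *
          Real.exp (Real.pi * ε)) * Real.exp (-(Real.pi * ε * s))) atTop (𝓝 0) := by
        simpa using hexp.const_mul ((N + N₀).factorial / (Real.pi * ε) ^ (N + N₀) * Real.exp (Real.pi * ε))
      have hsq : Tendsto (fun s : ℝ => (1 + s) ^ (N + N₀) * Real.exp (-(2 * Real.pi * s * ε)))
          atTop (𝓝 0) := by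
        refine squeeze_zero' ?_ ?_ hlim2
        · filter_upwards [eventually_ge_atTop (0 : ℝ)] with s hs; positivity
        · filter_upwards [eventually_ge_atTop (0 : ℝ)] with s hs; exact hbd2 s hs
      simpa using hsq.const_mul (A₁ * K * J)
    refine tendsto_zero_iff_norm_tendsto_zero.2 (squeeze_zero' ?_ ?_ hmaj)
    · exact Eventually.of_forall fun s => norm_nonneg _
    · filter_upwards [eventually_ge_atTop (0 : ℝ)] with s hs using hbound s hs
  ---------------------------------------------------------------------------------------------
  -- (v) conclusion
  ---------------------------------------------------------------------------------------------
  have hIs : ∀ s : ℝ, 0 ≤ s → h (I * s) = h 0 := fun s hs =>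
    hconst (hImU _ (by simpa using hs))
  have hlim0 : Tendsto (fun s : ℝ => h (I * s)) atTop (𝓝 (h 0)) := by
    refine tendsto_const_nhds.congr' ?_
    filter_upwards [eventually_ge_atTop (0 : ℝ)] with s hs using (hIs s hs).symm
  have h00 : h 0 = 0 := tendsto_nhds_unique hlim0 hdecay
  have hgoal : h 0 = ∫ x : Fin n → SpaceTime d, 𝔚 (rayC x y I) * Fκ 0 x := by
    simp only [hh, zero_smul, add_zero]
  rw [hgoal] at h00
  simpa [hFκ] using h00

end Core



/-! ### The upper temporal directions and the linear forms of the cover -/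

/- The **upper temporal direction** past `k` is `j ↦ if k < j then e₀ else 0` (ones at the
indices `> k`): purely temporal, non-decreasing times, so its time gaps are non-negative; the
linear form `p ↦ ⟨p̃, θ̃_k⟩ = ∑_{j > k} p_j⁰` is the upper partial energy sum. It is written out as
a lambda throughout (no definition is introduced). -/

/-- The upper temporal direction is purely temporal. [folklore] -/
theorem upperDir_apply_succ (k j : Fin n) (i : Fin d) :
    (fun j : Fin n => if k < j then e₀ d else 0) j i.succ = 0 := by
  simp only
  split_ifs <;> simp [e₀_apply, Fin.succ_ne_zero]

/-- Times of the upper temporal direction: `1` past `k`, `0` up to `k`. [folklore] -/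
theorem upperDir_apply_zero (k j : Fin n) :
    (fun j : Fin n => if k < j then e₀ d else 0) j 0 = if k < j then 1 else 0 := by
  simp only
  split_ifs <;> simp [e₀_apply]

/-- The time gaps of the upper temporal direction are non-negative (the times are monotone in
the index). [folklore] -/
theorem succDiff_upperDir_nonneg (k i : Fin n) :
    0 ≤ succDiff (fun j => (fun j : Fin n => if k < j then e₀ d else 0) j 0) i := by
  cases n with
  | zero => exact i.elim0
  | succ m =>
    refine Fin.cases ?_ (fun j => ?_) i
    · rw [succDiff_zero, upperDir_apply_zero]
      split_ifs <;> norm_num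
    · rw [succDiff_succ, upperDir_apply_zero, upperDir_apply_zero]
      by_cases h1 : k < Fin.castSucc j
      · have h2 : k < j.succ := h1.trans (Fin.castSucc_lt_succ (i := j))
        simp [h1, h2]
      · simp only [h1, if_false, sub_zero]
        split_ifs <;> norm_num

/-- `⟨p̃, θ̃_k⟩ = ∑_{j > k} p_j⁰`: the upper direction tests the upper partial energy sum. [folklore] -/
theorem inner_flattenCLE_upperDir (p : Fin n → SpaceTime d) (k : Fin n) :
    ⟪flattenCLE d n p, flattenCLE d n (fun j : Fin n => if k < j then e₀ d else 0)⟫ =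
      ∑ j ∈ Finset.univ.filter (fun j => k < j), p j 0 := by
  rw [inner_flattenCLE, Finset.sum_filter]
  refine Finset.sum_congr rfl fun j _ => ?_
  simp only
  split_ifs with h
  · rw [show e₀ d = EuclideanSpace.single 0 (1 : ℝ) from rfl, EuclideanSpace.inner_single_right]
    simp
  · simp

/-- `⟨p̃, ẽ_μ^diag⟩ = (∑ⱼ pⱼ)_μ`: the diagonal unit vectors test the components of the total
momentum. [folklore] -/
theorem inner_flattenCLE_diag_single (p : Fin n → SpaceTime d) (μ : Fin (d + 1)) :
    ⟪flattenCLE d n p, flattenCLE d n (fun _ : Fin n => EuclideanSpace.single μ (1 : ℝ))⟫ =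
      (∑ j, p j) μ := by
  rw [inner_flattenCLE, WithLp.ofLp_sum, Finset.sum_apply]
  refine Finset.sum_congr rfl fun j _ => ?_
  rw [EuclideanSpace.inner_single_right]
  simp

/-- **The cover of the complement of the half-space spectral set**: a flattened momentum
configuration outside `halfSpectralSet` has a non-zero component of its total momentum or a
positive upper partial energy sum. [folklore] -/
theorem compl_image_halfSpectralSet_subset :
    (flattenCLE d n '' halfSpectralSet d n)ᶜ ⊆
      (⋃ μ : Fin (d + 1), {w | ⟪w, flattenCLE d n (fun _ : Fin n => EuclideanSpace.single μ (1 : ℝ))⟫ ≠ 0}) ∪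
        ⋃ k : Fin n, {w | 0 < ⟪w, flattenCLE d n (fun j : Fin n => if k < j then e₀ d else 0)⟫} := by
  intro w hw
  set p : Fin n → SpaceTime d := (flattenCLE d n).symm w with hp
  have hwp : w = flattenCLE d n p := by rw [hp, ContinuousLinearEquiv.apply_symm_apply]
  have hpS : p ∉ halfSpectralSet d n := fun h => hw ⟨p, h, hwp.symm⟩
  rw [mem_halfSpectralSet_iff, not_and_or] at hpS
  by_cases hsum : ∑ j, p j = 0
  · -- some partial sum has negative energy
    rcases hpS with h | h
    · exact absurd hsum h
    push Not at h
    obtain ⟨k, hk⟩ := h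
    refine Or.inr (mem_iUnion.2 ⟨k, ?_⟩)
    show 0 < ⟪w, flattenCLE d n (fun j : Fin n => if k < j then e₀ d else 0)⟫
    rw [hwp, inner_flattenCLE_upperDir]
    -- `∑_{j ≤ k} + ∑_{j > k} = ∑_j = 0` in the time component
    have hIic : Finset.Iic k = Finset.univ.filter (fun j : Fin n => j ≤ k) := by
      ext j; simp
    have hsplit := Finset.sum_filter_add_sum_filter_not Finset.univ (fun j : Fin n => j ≤ k)
      (fun j => p j 0)
    have hnot : Finset.univ.filter (fun j : Fin n => ¬j ≤ k) = Finset.univ.filter (fun j => k < j) := by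
      ext j; simp [not_le]
    rw [hnot, ← hIic] at hsplit
    have htot : ∑ j, p j 0 = 0 := by
      have := congrArg (fun q : SpaceTime d => q 0) hsum
      simpa [WithLp.ofLp_sum, Finset.sum_apply] using this
    have hk' : (∑ j ∈ Finset.Iic k, p j) 0 = ∑ j ∈ Finset.Iic k, p j 0 := by
      rw [WithLp.ofLp_sum, Finset.sum_apply]
    rw [hk'] at hk
    linarith
  · -- a component of the total momentum is non-zero
    have hμ : ∃ μ : Fin (d + 1), (∑ j, p j) μ ≠ 0 := by
      by_contra hall
      push Not at hall
      exact hsum (PiLp.ext hall)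
    obtain ⟨μ, hμ⟩ := hμ
    refine Or.inl (mem_iUnion.2 ⟨μ, ?_⟩)
    show ⟪w, flattenCLE d n (fun _ : Fin n => EuclideanSpace.single μ (1 : ℝ))⟫ ≠ 0
    rwa [hwp, inner_flattenCLE_diag_single]

/-! ### Vanishing on the two kinds of cover sets -/

section Vanishing

variable {𝔚 : (Fin n → Fin (d + 1) → ℂ) → ℂ}
  (hGc : ContinuousOn 𝔚 (timeTube d n)) (hGh : IsTimeHolomorphicOn 𝔚 (timeTube d n))
  (hW : HasOSGrowth 𝔚)
  (htr : ∀ z ∈ timeTube d n, ∀ a : SpaceTime d, 𝔚 (fun k => z k + complexifyPoint a) = 𝔚 z)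
  {T : 𝓢((Fin n → SpaceTime d), ℂ) →L[ℂ] ℂ}
  (hT : ∀ η ∈ temporalCone d n, ∀ F : 𝓢((Fin n → SpaceTime d), ℂ),
    Tendsto (fun t : ℝ => ∫ x : Fin n → SpaceTime d, 𝔚 (rayC x (t • η) I) * F x) (𝓝[>] 0)
      (𝓝 (T F)))

include hGc hW htr hT in
/-- **Vanishing on `U_μ` (translation invariance).** For every `G ∈ 𝓢` on the Fourier side,
`T(unflatten 𝓕⁻¹(⟨·, ẽ_μ^diag⟩ G)) = 0`: `𝓕⁻¹(⟨·, m⟩ G) = (2πi)⁻¹ ∂_m 𝓕⁻¹G` and the boundary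
value kills diagonal derivatives. [folklore] -/
theorem apply_fourierInv_smulLeftCLM_inner_diag_eq_zero (μ : Fin (d + 1))
    (G : 𝓢(EuclideanSpace ℝ (Fin n × Fin (d + 1)), ℂ)) :
    T (SchwartzMap.compCLMOfContinuousLinearEquiv ℂ (flattenCLE d n)
      (𝓕⁻ (SchwartzMap.smulLeftCLM ℂ (fun w => ((⟪w, flattenCLE d n
        (fun _ : Fin n => EuclideanSpace.single μ (1 : ℝ))⟫ : ℝ) : ℂ)) G))) = 0 := by
  set m : EuclideanSpace ℝ (Fin n × Fin (d + 1)) :=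
    flattenCLE d n (fun _ : Fin n => EuclideanSpace.single μ (1 : ℝ)) with hm
  have hgr : (fun w : EuclideanSpace ℝ (Fin n × Fin (d + 1)) => ⟪w, m⟫).HasTemperateGrowth :=
    ((innerSL ℝ).flip m).hasTemperateGrowth
  have hgc : (fun w : EuclideanSpace ℝ (Fin n × Fin (d + 1)) => ((⟪w, m⟫ : ℝ) : ℂ)).HasTemperateGrowth :=
    Complex.ofRealCLM.hasTemperateGrowth.comp hgr
  -- the complex multiplier is the real one
  have h1 : SchwartzMap.smulLeftCLM ℂ (fun w => ((⟪w, m⟫ : ℝ) : ℂ)) G =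
      SchwartzMap.smulLeftCLM ℂ (fun w => ⟪w, m⟫) G := by
    ext w
    rw [SchwartzMap.smulLeftCLM_apply_apply hgc, SchwartzMap.smulLeftCLM_apply_apply hgr,
      smul_eq_mul, Complex.real_smul]
  -- `𝓕⁻¹(⟨·, m⟩ G) = (2πi)⁻¹ ∂_m 𝓕⁻¹ G`
  have h2πI : (2 * Real.pi * I : ℂ) ≠ 0 := by simp [Real.pi_ne_zero]
  have h2 : (𝓕⁻ (SchwartzMap.smulLeftCLM ℂ (fun w => ⟪w, m⟫) G) :
      𝓢(EuclideanSpace ℝ (Fin n × Fin (d + 1)), ℂ)) =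
      (2 * Real.pi * I : ℂ)⁻¹ • ∂_{m} (𝓕⁻ G : 𝓢(EuclideanSpace ℝ (Fin n × Fin (d + 1)), ℂ)) := by
    rw [SchwartzMap.lineDerivOp_fourierInv_eq G m, fourierInv_smul, smul_smul,
      inv_mul_cancel₀ h2πI, one_smul]
  have h3 := SchwartzMap.lineDerivOp_compCLMOfContinuousLinearEquiv ℂ
    (fun _ : Fin n => EuclideanSpace.single μ (1 : ℝ)) (flattenCLE d n)
    (𝓕⁻ G : 𝓢(EuclideanSpace ℝ (Fin n × Fin (d + 1)), ℂ))
  rw [← hm] at h3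
  rw [h1, h2, map_smul, map_smul, ← h3,
    apply_lineDerivOp_diag_eq_zero hGc hW htr hT (EuclideanSpace.single μ (1 : ℝ)) _, smul_zero]

include hGc hW htr hT in
/-- **Vanishing on `U_μ`, cut-off form**: for `θ ∈ C_c^∞(ℝ)` supported in `{r ≠ 0}`,
`T(unflatten 𝓕⁻¹(θ(⟨·, ẽ_μ^diag⟩) G)) = 0` (write `θ(r) = r · (θ(r)/r)` with `θ(r)/r ∈ C_c^∞`).
[folklore] -/
theorem apply_fourierInv_smulLeftCLM_cutoff_inner_diag_eq_zero (μ : Fin (d + 1)) {θ : ℝ → ℝ}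
    (hθ : ContDiff ℝ ∞ θ) (hθc : HasCompactSupport θ) (hθW : tsupport θ ⊆ {r : ℝ | r ≠ 0})
    (G : 𝓢(EuclideanSpace ℝ (Fin n × Fin (d + 1)), ℂ)) :
    T (SchwartzMap.compCLMOfContinuousLinearEquiv ℂ (flattenCLE d n)
      (𝓕⁻ (SchwartzMap.smulLeftCLM ℂ (fun w => ((θ ⟪w, flattenCLE d n
        (fun _ : Fin n => EuclideanSpace.single μ (1 : ℝ))⟫ : ℝ) : ℂ)) G))) = 0 := by
  set m : EuclideanSpace ℝ (Fin n × Fin (d + 1)) :=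
    flattenCLE d n (fun _ : Fin n => EuclideanSpace.single μ (1 : ℝ)) with hm
  -- `θ₁(r) = θ(r)/r` is smooth and compactly supported
  set θ₁ : ℝ → ℝ := fun r => θ r / r with hθ₁
  have h0 : (0 : ℝ) ∉ tsupport θ := fun h => hθW h rfl
  have hθ₁s : ContDiff ℝ ∞ θ₁ := by
    refine contDiff_iff_contDiffAt.2 fun r => ?_
    by_cases hr : r = 0
    · subst hr
      have hev : θ₁ =ᶠ[𝓝 0] fun _ => 0 := by
        have hnhds : (tsupport θ)ᶜ ∈ 𝓝 (0 : ℝ) := (isClosed_tsupport θ).isOpen_compl.mem_nhds h0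
        filter_upwards [hnhds] with r hr
        simp [hθ₁, image_eq_zero_of_notMem_tsupport hr]
      exact (contDiffAt_const (c := (0 : ℝ))).congr_of_eventuallyEq hev
    · exact hθ.contDiffAt.div contDiffAt_id hr
  have hθ₁c : HasCompactSupport θ₁ :=
    hθc.mono fun r hr => by
      simp only [Function.mem_support, ne_eq, hθ₁, div_eq_zero_iff, not_or] at hr
      exact hr.1
  have hgr : (fun w : EuclideanSpace ℝ (Fin n × Fin (d + 1)) => ⟪w, m⟫).HasTemperateGrowth :=
    ((innerSL ℝ).flip m).hasTemperateGrowth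
  have hgc : (fun w : EuclideanSpace ℝ (Fin n × Fin (d + 1)) => ((⟪w, m⟫ : ℝ) : ℂ)).HasTemperateGrowth :=
    Complex.ofRealCLM.hasTemperateGrowth.comp hgr
  have hg₁ : (fun w : EuclideanSpace ℝ (Fin n × Fin (d + 1)) => ((θ₁ ⟪w, m⟫ : ℝ) : ℂ)).HasTemperateGrowth :=
    (Complex.ofRealCLM.hasTemperateGrowth.comp (hθ₁c.hasTemperateGrowth hθ₁s)).comp hgr
  have hg : (fun w : EuclideanSpace ℝ (Fin n × Fin (d + 1)) => ((θ ⟪w, m⟫ : ℝ) : ℂ)).HasTemperateGrowth :=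
    (Complex.ofRealCLM.hasTemperateGrowth.comp (hθc.hasTemperateGrowth hθ)).comp hgr
  -- `θ(⟨w, m⟩) G = ⟨w, m⟩ · (θ₁(⟨w, m⟩) G)`
  have hfac : ∀ r : ℝ, θ r = r * θ₁ r := by
    intro r
    by_cases hr : r = 0
    · subst hr; simp [image_eq_zero_of_notMem_tsupport h0]
    · simp only [hθ₁]; field_simp
  have hfg : (fun w : EuclideanSpace ℝ (Fin n × Fin (d + 1)) => ((θ ⟪w, m⟫ : ℝ) : ℂ)) =
      (fun w => ((⟪w, m⟫ : ℝ) : ℂ)) * fun w => ((θ₁ ⟪w, m⟫ : ℝ) : ℂ) := by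
    funext w
    simp only [Pi.mul_apply, hfac ⟪w, m⟫, Complex.ofReal_mul]
  have heq : SchwartzMap.smulLeftCLM ℂ (fun w => ((θ ⟪w, m⟫ : ℝ) : ℂ)) G =
      SchwartzMap.smulLeftCLM ℂ (fun w => ((⟪w, m⟫ : ℝ) : ℂ))
        (SchwartzMap.smulLeftCLM ℂ (fun w => ((θ₁ ⟪w, m⟫ : ℝ) : ℂ)) G) := by
    rw [SchwartzMap.smulLeftCLM_smulLeftCLM_apply hgc hg₁, ← hfg]
  rw [heq]
  exact apply_fourierInv_smulLeftCLM_inner_diag_eq_zero hGc hW htr hT μ _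

include hGc hGh hW hT in
/-- **Vanishing on `V_k` (Paley–Wiener).** For `θ ∈ C_c^∞(ℝ)` supported in `(0, ∞)` and
`G ∈ 𝓢`, `T(unflatten 𝓕⁻¹(θ(⟨·, θ̃_k⟩) G)) = 0`: all slice pairings of `𝔚` with this test
function vanish (`integral_rayC_I_mul_fourierInv_expMult_eq_zero`). [cite: StreaterWightman1964, Thm 2-8] -/
theorem apply_fourierInv_smulLeftCLM_cutoff_inner_upper_eq_zero (k : Fin n) {θ : ℝ → ℝ}
    (hθ : ContDiff ℝ ∞ θ) (hθc : HasCompactSupport θ) (hθW : tsupport θ ⊆ Ioi 0)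
    (G : 𝓢(EuclideanSpace ℝ (Fin n × Fin (d + 1)), ℂ)) :
    T (SchwartzMap.compCLMOfContinuousLinearEquiv ℂ (flattenCLE d n)
      (𝓕⁻ (SchwartzMap.smulLeftCLM ℂ (fun w =>
        ((θ ⟪w, flattenCLE d n (fun j : Fin n => if k < j then e₀ d else 0)⟫ : ℝ) : ℂ))
        G))) = 0 := by
  obtain ⟨C, N, hG⟩ := hW
  set θc : ℝ → ℂ := fun r => (θ r : ℂ) with hθc_def
  have hθcs : ContDiff ℝ ∞ θc := Complex.ofRealCLM.contDiff.comp hθ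
  have hθcc : HasCompactSupport θc := hθc.comp_left Complex.ofReal_zero
  have hsupp : tsupport θc ⊆ tsupport θ := tsupport_comp_subset Complex.ofReal_zero _
  -- a positive lower bound for the support
  obtain ⟨ε, hε, hθε⟩ : ∃ ε : ℝ, 0 < ε ∧ ∀ r ∈ tsupport θ, ε ≤ r := by
    rcases (tsupport θ).eq_empty_or_nonempty with h | hne
    · exact ⟨1, one_pos, fun r hr => by simp [h] at hr⟩
    · obtain ⟨r₀, hr₀, hmin⟩ := hθc.isCompact.exists_isMinOn hne continuousOn_id
      exact ⟨r₀, hθW hr₀, fun r hr => hmin hr⟩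
  -- the multiplier is `expMult θc θ̃_k 0`
  have hmult : (fun w : EuclideanSpace ℝ (Fin n × Fin (d + 1)) =>
      ((θ ⟪w, flattenCLE d n (fun j : Fin n => if k < j then e₀ d else 0)⟫ : ℝ) : ℂ)) =
        expMult θc (flattenCLE d n (fun j : Fin n => if k < j then e₀ d else 0)) 0 := by
    funext w
    simp [expMult_apply, hθc_def]
  rw [hmult]
  refine apply_eq_zero_of_forall_integral_rayC_I_eq_zero hT fun y hy => ?_
  have h := integral_rayC_I_mul_fourierInv_expMult_eq_zero hGc hGh hG hy (upperDir_apply_succ k)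
    (succDiff_upperDir_nonneg k) hθcs hθcc hε (fun r hr => hθε r (hsupp hr)) G
  simpa [SchwartzMap.compCLMOfContinuousLinearEquiv_apply] using h

end Vanishing

/-! ### Assembly: the half-space spectral support -/

/-- **Half-space spectral support of the time-ray boundary value.** Let `𝔚` be continuous on the
time tube, holomorphic in the times, invariant under real diagonal translations and of OS growth,
and let `T` be a continuous linear functional with `∫ 𝔚(x + itη) F(x) dx → T(F)` (`t → 0⁺`) for
every temporal `η` and every Schwartz `F`. Then the Fourier transform of `T` is supported in the
half-space spectral set `{∑ⱼ pⱼ = 0, (∑_{j ≤ k} pⱼ)⁰ ≥ 0}` (`FourierSupportedIn`, the test-function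
form and sign convention of `HasSpectralCondition`) — Osterwalder–Schrader II (1975), §IV.2
p. 289 / OS I (1973), p. 93: "support in `{q⁰_j ≥ 0}`". [cite: OsterwalderSchraderCMP1975, §IV.2 p. 289] -/
theorem fourierSupportedIn_halfSpectralSet_of_tendsto {𝔚 : (Fin n → Fin (d + 1) → ℂ) → ℂ}
    (hGc : ContinuousOn 𝔚 (timeTube d n)) (hGh : IsTimeHolomorphicOn 𝔚 (timeTube d n))
    (hW : HasOSGrowth 𝔚)
    (htr : ∀ z ∈ timeTube d n, ∀ a : SpaceTime d, 𝔚 (fun k => z k + complexifyPoint a) = 𝔚 z)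
    {T : 𝓢((Fin n → SpaceTime d), ℂ) →L[ℂ] ℂ}
    (hT : ∀ η ∈ temporalCone d n, ∀ F : 𝓢((Fin n → SpaceTime d), ℂ),
      Tendsto (fun t : ℝ => ∫ x : Fin n → SpaceTime d, 𝔚 (rayC x (t • η) I) * F x) (𝓝[>] 0)
        (𝓝 (T F))) :
    FourierSupportedIn T (halfSpectralSet d n) := by
  -- the functional on the Fourier side
  set Φ : 𝓢(EuclideanSpace ℝ (Fin n × Fin (d + 1)), ℂ) →L[ℂ] 𝓢((Fin n → SpaceTime d), ℂ) :=
    (SchwartzMap.compCLMOfContinuousLinearEquiv ℂ (flattenCLE d n)).comp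
      (FourierTransform.fourierInvCLM ℂ (𝓢(EuclideanSpace ℝ (Fin n × Fin (d + 1)), ℂ))) with hΦ
  set T' : 𝓢(EuclideanSpace ℝ (Fin n × Fin (d + 1)), ℂ) →L[ℂ] ℂ := T.comp Φ with hT'
  have hT'apply : ∀ ψ : 𝓢(EuclideanSpace ℝ (Fin n × Fin (d + 1)), ℂ),
      T' ψ = T (SchwartzMap.compCLMOfContinuousLinearEquiv ℂ (flattenCLE d n) (𝓕⁻ ψ)) :=
    fun ψ => rfl
  have hTF : ∀ F : 𝓢((Fin n → SpaceTime d), ℂ), T F = T' (𝓕 (flattenTest F)) := fun F => by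
    simp only [hT', ContinuousLinearMap.comp_apply]
    congr 1
    ext x
    simp [hΦ, flattenTest_apply]
  -- the cover sets and the linear forms
  set mdiag : Fin (d + 1) → EuclideanSpace ℝ (Fin n × Fin (d + 1)) := fun μ =>
    flattenCLE d n (fun _ : Fin n => EuclideanSpace.single μ (1 : ℝ)) with hmdiag
  set mup : Fin n → EuclideanSpace ℝ (Fin n × Fin (d + 1)) := fun k =>
    flattenCLE d n (fun j : Fin n => if k < j then e₀ d else 0) with hmup
  set W : Fin (d + 1) ⊕ Fin n → Set (EuclideanSpace ℝ (Fin n × Fin (d + 1))) := fun i =>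
    Sum.elim (fun μ => {w | ⟪w, mdiag μ⟫ ≠ 0}) (fun k => {w | 0 < ⟪w, mup k⟫}) i with hWdef
  have hℓ : ∀ (m w : EuclideanSpace ℝ (Fin n × Fin (d + 1))), (innerSL ℝ).flip m w = ⟪w, m⟫ :=
    fun m w => by rw [ContinuousLinearMap.flip_apply, innerSL_apply_apply]
  have hWo : ∀ i, IsOpen (W i) := by
    rintro (μ | k)
    · exact isOpen_ne_fun (continuous_id.inner continuous_const) continuous_const
    · exact isOpen_lt continuous_const (continuous_id.inner continuous_const)
  have hWv : ∀ i, SchwartzSupport.IsVanishingOnCompact T' (W i) := by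
    rintro (μ | k)
    · have hpre : W (Sum.inl μ) = ((innerSL ℝ).flip (mdiag μ)) ⁻¹' {r : ℝ | r ≠ 0} := by
        ext w
        simp only [hWdef, Sum.elim_inl, mem_setOf_eq, mem_preimage, hℓ]
      rw [hpre]
      refine SchwartzSupport.isVanishingOnCompact_preimage T' _ isOpen_ne fun θ hθ hθc hθW G => ?_
      rw [hT'apply]
      have hfun : (fun w => ((θ ((innerSL ℝ).flip (mdiag μ) w) : ℝ) : ℂ)) =
          fun w => ((θ ⟪w, mdiag μ⟫ : ℝ) : ℂ) := by funext w; rw [hℓ]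
      rw [hfun]
      exact apply_fourierInv_smulLeftCLM_cutoff_inner_diag_eq_zero hGc hW htr hT μ hθ hθc hθW G
    · have hpre : W (Sum.inr k) = ((innerSL ℝ).flip (mup k)) ⁻¹' Ioi 0 := by
        ext w
        simp only [hWdef, Sum.elim_inr, mem_setOf_eq, mem_preimage, mem_Ioi, hℓ]
      rw [hpre]
      refine SchwartzSupport.isVanishingOnCompact_preimage T' _ isOpen_Ioi fun θ hθ hθc hθW G => ?_
      rw [hT'apply]
      have hfun : (fun w => ((θ ((innerSL ℝ).flip (mup k) w) : ℝ) : ℂ)) =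
          fun w => ((θ ⟪w, mup k⟫ : ℝ) : ℂ) := by funext w; rw [hℓ]
      rw [hfun]
      exact apply_fourierInv_smulLeftCLM_cutoff_inner_upper_eq_zero hGc hGh hW hT k hθ hθc hθW G
  have hglue : Distribution.IsVanishingOn (T' : 𝓢(EuclideanSpace ℝ (Fin n × Fin (d + 1)), ℂ) → ℂ)
      (⋃ i, W i) := SchwartzSupport.isVanishingOn_iUnion T' hWo hWv
  have hcover : (flattenCLE d n '' halfSpectralSet d n)ᶜ ⊆ ⋃ i, W i := by
    intro w hw
    rcases compl_image_halfSpectralSet_subset hw with h | h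
    · obtain ⟨μ, hμ⟩ := mem_iUnion.1 h
      exact mem_iUnion.2 ⟨Sum.inl μ, hμ⟩
    · obtain ⟨k, hk⟩ := mem_iUnion.1 h
      exact mem_iUnion.2 ⟨Sum.inr k, hk⟩
  intro F hF
  rw [hTF]
  exact hglue.mono hcover _ (subset_compl_iff_disjoint_right.2 hF)


/-! ### The discharge of (A2) and the assemblies -/

/-- **(A2) holds: the tempered time-ray boundary value of an OS time continuation exists and has
half-space spectral support** (Osterwalder–Schrader II (1975), §IV.2 p. 289, via Vladimirov §26 /
Hörmander Thm. 3.1.15 for the existence and the Paley–Wiener theorem for the support; module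
docstring). [cite: OsterwalderSchraderCMP1975, §IV.2 p. 289 (Thm. 4.3 ⇒ W̃_k; (4.7))] -/
theorem OS1975_boundaryValue_of_timeContinuation_holds : OS1975_boundaryValue_of_timeContinuation := by
  intro d n 𝔚 hGc hGh htr hW
  obtain ⟨T, hbv, hT⟩ := exists_clm_tendsto_integral_rayC_I hGc hGh hW
  exact ⟨T, hbv, fourierSupportedIn_halfSpectralSet_of_tendsto hGc hGh hW htr hT⟩

/-- **(A₁₂⁺) from (A1) and (B) alone**, (A2) and (D) being theorems. Real proof. [cite: OsterwalderSchraderCMP1975, §IV.2 pp. 288–289] -/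
theorem OS1975_exists_continuation_halfSpace_of_A1_B
    (hA1 : OS1975_exists_timeContinuation) (hB : OS1973_lorentzInvariant_of_timeContinuation) :
    OS1975_exists_continuation_halfSpace :=
  OS1975_exists_continuation_halfSpace_of_timeContinuation' hA1
    OS1975_boundaryValue_of_timeContinuation_holds hB

/-- **(A₁₂) `OS1975_exists_forwardTube_continuation` from (A1) and (B) alone.** Real proof. [cite: OsterwalderSchraderCMP1975, §IV.2 pp. 288–289] -/
theorem OS1975_exists_forwardTube_continuation_of_A1_B
    (hA1 : OS1975_exists_timeContinuation) (hB : OS1973_lorentzInvariant_of_timeContinuation) :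
    OS1975_exists_forwardTube_continuation :=
  OS1975_exists_forwardTube_continuation_of_timeContinuation' hA1
    OS1975_boundaryValue_of_timeContinuation_holds hB

/-- **`os_reconstruction` from (A1), (B), locality, positivity and the cluster property**, (A2)
and (D) being theorems. Real proof. [cite: OsterwalderSchraderCMP1975, §IV.1 Thm. E'→R'] -/
theorem os_reconstruction_of_A1_B
    (hA1 : OS1975_exists_timeContinuation) (hB : OS1973_lorentzInvariant_of_timeContinuation)
    (hR3 : OS1973_local) (hR2 : OS1973_positiveDefinite) (hR4 : OS1973_cluster) :
    os_reconstruction :=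
  os_reconstruction_of_timeContinuation' hA1 OS1975_boundaryValue_of_timeContinuation_holds hB
    hR3 hR2 hR4

end Literature.MathematicalPhysics.QuantumFieldTheory
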